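import Mathlib
import HarnessLib
import Summits.HubbardSuperconductivity.HubbardSuperconductivity.Theorems.KLProgrammeKLRegimeEngineV8Raise

/-!
# K3 ENGINE package doors along a RAISE `Q₀.IsRaiseOf Q` (`CR`, `CE` weakly up, every other row pinned) for the V17F2 slots
# (plan g19 (R57b)(ii) advisory: «closers pinned at `klEngQ8` need the cheap Q8 → Q9 raise transfer»; token #13 = `klEngQ9 P R` =
# a `CR`- then `CE`-raise of `klEngQ8 P R` under EVERY table, body frozen 08-29)

Cell `gate-hubbard-kl`, seat hubbard-kl-k3c2-p1 g6 (the k3c2-p1 lineage owns `…EngineV8Raise` / the `Q`-Defs chain; this is the slot-door companion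
of `…EngineV8Raise`, generic in the raise so that it lands BEFORE `…DefsQ9` and serves both tables).

`…EngineV8DefsQ8` §1 has the `withCR` doors (the `CR`-readers `legDressBarQ2`/`eremBar`/`frameShiftBar`/(B1-F) tolerance are monotone, the
`CE`/`S'`/`cE4`-readers `Iff.rfl`).  A raise ALSO moves `CE`, read by exactly three engine predicates — (E1-v4) `KernelNormsV4` (`Q.CE^p`), the levelled
norms `KernelNormsLevels` (`Q.CE^p`) and the (E1-W) budget `klWtBudget` (`Q.CE^{m/2}`) — all three MONOTONE in `CE` conclusion-side; every other slot
predicate is `CE`-free.  Hence: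

* §1 `withCE` doors: `Iff.rfl` for the `CE`-free readers (`pairLadderStepAtV17F2_withCE_iff`, `pairValueIncrementAtV17F_withCE_iff`,
  `quarticValueIncrementAtV17F_withCE_iff`, `quarticValueUVAtV17F_withCE_iff`, `pairArrayAtV17F_withCE_iff`, `betaSplitAtV17F_withCE_iff`,
  `engineFirstMoments_withCE_iff`, `twoLegReadJetsF_withCE_iff`, `twoLegVolumeRateF_zero_withCE_iff`), and the monotone lifts `kernelNormsV4_withCE_of`,
  `kernelNormsLevels_withCE_of`, `klWtBudget_le_withCE`, `kernelNormsWt4_klWtBudget_withCE_of` (`0 ≤ Q.CE ≤ e`, `0 ≤ P.Klam`), `engineBoundsAtV17F2_withCE_of`,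
  `histV17F2_withCE_of`;
* §2 **`IsRaiseOf` doors** (`hQ : Q₀.IsRaiseOf Q`, `0 ≤ P.Klam`, and `0 ≤ Q₀.CE` where `CE` is read): every value clause, the split slot, (E1-v4), the levels,
  the weighted levels at the budget, the whole engine slot **`engineBoundsAtV17F2_of_isRaiseOf`** and the comparison-volume history conjunct
  **`histV17F2_of_isRaiseOf`** lift `Q₀ → Q`; (E4) / (E3a-F) / (E3f-F)₀ are invariant (`…_isRaiseOf_iff`).
  NOT provided (false in general, as in …DefsQ8): lifts of `TwoLegStepV17F2 … Q …` at `n ≥ 1` or of a `HistP … Q …` HYPOTHESIS.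

Instantiation: `hQ := isRaiseOf_klEngQ8 P R` (Q7 → Q8, recovers …DefsQ8 §3), `hQ := isRaiseOf_klEngQ9 P R` / `isRaiseOf_klEngQ9_klEngQ8 P R` (…DefsQ9, after the
freeze).  Order lemmas only; nothing about the model is asserted; nothing asserts superconductivity.
-/

noncomputable section

namespace Summit.HubbardSuperconductivity.HubbardSuperconductivity.Theorems.KLRegimeSplit

set_option linter.dupNamespace false -- summit = problem name (single-conjunct summit), D-0017

open Real Finset Literature.MathematicalPhysics.QuantumLattice Literature.Probability.LatticeModels
open Summit.HubbardSuperconductivity.HubbardSuperconductivity.Theorems.KLProgrammeLegKernels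
open Summit.HubbardSuperconductivity.HubbardSuperconductivity.Theorems.EngineV8

/-! ## §1 `withCE` doors -/

section Bars

variable (G : GeoConsts) (P : SplitConsts) (Q : EngConsts) (e : ℝ)

/-- `twoLegBar` reads only `S'` (untouched by `withCE`). -/
theorem twoLegBar_withCE (U : ℝ) (j n : ℕ) : twoLegBar G (Q.withCE e) U j n = twoLegBar G Q U j n := rfl

/-- `legDressBarQ2` reads only `CR` (untouched by `withCE`). -/
theorem legDressBarQ2_withCE (U : ℝ) (n c : ℕ) : legDressBarQ2 G P (Q.withCE e) U n c = legDressBarQ2 G P Q U n c := rfl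

/-- `frameShiftBar` reads only `CR`. -/
theorem frameShiftBar_withCE (U : ℝ) (n : ℕ) : frameShiftBar P (Q.withCE e) U n = frameShiftBar P Q U n := rfl

/-- `eremBar` reads only `CR`, `CL`. -/
theorem eremBar_withCE (U β : ℝ) (L n : ℕ) : eremBar G P (Q.withCE e) U β L n = eremBar G P Q U β L n := rfl

/-- The (E1-W) budget at `Q.withCE e` is the `CE := e` reading. -/
theorem klWtBudget_withCE (U : ℝ) (j m : ℕ) :
    klWtBudget P (Q.withCE e) U j m = e ^ (m / 2) * epsCoupling P U j ^ max 1 (m / 2 - 1) * (2 : ℝ) ^ ((3 * ((m / 2 : ℕ) : ℤ) - 5) * j) := rfl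

variable {Q e}

/-- **The (E1-W) budget is monotone along the `CE`-raise** (`0 ≤ Q.CE ≤ e`, `0 ≤ P.Klam`). -/
theorem klWtBudget_le_withCE (hCE0 : 0 ≤ Q.CE) (he : Q.CE ≤ e) (hK : 0 ≤ P.Klam) (U : ℝ) (j m : ℕ) :
    klWtBudget P Q U j m ≤ klWtBudget P (Q.withCE e) U j m := by
  rw [klWtBudget_withCE]
  unfold klWtBudget
  have hε : 0 ≤ epsCoupling P U j := epsCoupling_nonneg' hK U j
  have hpow : Q.CE ^ (m / 2) ≤ e ^ (m / 2) := pow_le_pow_left₀ hCE0 he _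
  have h2 : 0 ≤ epsCoupling P U j ^ max 1 (m / 2 - 1) * (2 : ℝ) ^ ((3 * ((m / 2 : ℕ) : ℤ) - 5) * j) :=
    mul_nonneg (pow_nonneg hε _) (zpow_nonneg (by norm_num) _)
  calc Q.CE ^ (m / 2) * epsCoupling P U j ^ max 1 (m / 2 - 1) * (2 : ℝ) ^ ((3 * ((m / 2 : ℕ) : ℤ) - 5) * j)
      = Q.CE ^ (m / 2) * (epsCoupling P U j ^ max 1 (m / 2 - 1) * (2 : ℝ) ^ ((3 * ((m / 2 : ℕ) : ℤ) - 5) * j)) := by ring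
    _ ≤ e ^ (m / 2) * (epsCoupling P U j ^ max 1 (m / 2 - 1) * (2 : ℝ) ^ ((3 * ((m / 2 : ℕ) : ℤ) - 5) * j)) :=
        mul_le_mul_of_nonneg_right hpow h2
    _ = _ := by ring

end Bars

section Model

variable {L M : ℕ} [NeZero L] [NeZero M] {G : GeoConsts} {P : SplitConsts} {Q : EngConsts} {R : RenConsts} {β U μ : ℝ}
  {K : TrigPolyC4v} {n : ℕ} {e : ℝ}

/-- (E2-F2)ₙ is unchanged by `withCE` (reads `CR`, `CL`, `G` only). -/
theorem pairLadderStepAtV17F2_withCE_iff : PairLadderStepAtV17F2 L M G P (Q.withCE e) β U μ n ↔ PairLadderStepAtV17F2 L M G P Q β U μ n := Iff.rfl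

/-- (E2″-F)ₙ is unchanged by `withCE`. -/
theorem pairValueIncrementAtV17F_withCE_iff : PairValueIncrementAtV17F L M G P (Q.withCE e) β U μ n ↔ PairValueIncrementAtV17F L M G P Q β U μ n :=
  Iff.rfl

/-- (E2′-F)ₙ is unchanged by `withCE`. -/
theorem quarticValueIncrementAtV17F_withCE_iff :
    QuarticValueIncrementAtV17F L M G P (Q.withCE e) β U μ n ↔ QuarticValueIncrementAtV17F L M G P Q β U μ n := Iff.rfl

/-- (E2′-F UV)ₙ is unchanged by `withCE`. -/
theorem quarticValueUVAtV17F_withCE_iff : QuarticValueUVAtV17F L M G P (Q.withCE e) β U μ n ↔ QuarticValueUVAtV17F L M G P Q β U μ n := Iff.rfl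

/-- (B1-F) is unchanged by `withCE` (reads `CR`). -/
theorem pairArrayAtV17F_withCE_iff : PairArrayAtV17F L M P (Q.withCE e) β U μ n ↔ PairArrayAtV17F L M P Q β U μ n := Iff.rfl

/-- The split slot is unchanged by `withCE`. -/
theorem betaSplitAtV17F_withCE_iff : BetaSplitAtV17F L M G P (Q.withCE e) β U μ n ↔ BetaSplitAtV17F L M G P Q β U μ n := Iff.rfl

/-- (E4) is unchanged by `withCE` (reads `Q.cE4`). -/
theorem engineFirstMoments_withCE_iff : EngineFirstMoments L M G P (Q.withCE e) β U μ K n ↔ EngineFirstMoments L M G P Q β U μ K n := Iff.rfl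

/-- (E3a-F) is unchanged by `withCE` (reads `Q.S'`). -/
theorem twoLegReadJetsF_withCE_iff : TwoLegReadJetsF L M G (Q.withCE e) β U μ n ↔ TwoLegReadJetsF L M G Q β U μ n := Iff.rfl

/-- (E3f-F) at `n = 0` is unchanged by `withCE` for ANY two histories (reads `Q.M0`, `Q.CL`; the history enters only through `∀ j < 0`). -/
theorem twoLegVolumeRateF_zero_withCE_iff (hist hist' : (L' M' : ℕ) → [NeZero L'] → [NeZero M'] → ℕ → Prop) :
    TwoLegVolumeRateF L M hist (Q.withCE e) β U μ 0 ↔ TwoLegVolumeRateF L M hist' Q β U μ 0 := by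
  unfold TwoLegVolumeRateF
  simp only [EngConsts.withCE_M0, EngConsts.withCE_CL, Nat.not_lt_zero, IsEmpty.forall_iff, implies_true, forall_const]

omit [NeZero M] in
/-- **(E1-v4) lifts along the `CE`-raise** (`0 ≤ Q.CE ≤ e`, `0 ≤ P.Klam`; every frame, every scale). -/
theorem kernelNormsV4_withCE_of (hCE0 : 0 ≤ Q.CE) (he : Q.CE ≤ e) (hK : 0 ≤ P.Klam) (h : KernelNormsV4 L M P Q β U μ K n) :
    KernelNormsV4 L M P (Q.withCE e) β U μ K n := by
  intro p hp
  refine (h p hp).trans ?_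
  rw [EngConsts.withCE_CE]
  have hε : 0 ≤ epsCoupling P U n := epsCoupling_nonneg' hK U n
  have hpow : Q.CE ^ p ≤ e ^ p := pow_le_pow_left₀ hCE0 he p
  have h2 : 0 ≤ (epsCoupling P U n) ^ (p - 1) * (2 : ℝ) ^ ((3 * (p : ℤ) - 5) * n) :=
    mul_nonneg (pow_nonneg hε _) (zpow_nonneg (by norm_num) _)
  calc Q.CE ^ p * (epsCoupling P U n) ^ (p - 1) * (2 : ℝ) ^ ((3 * (p : ℤ) - 5) * n)
      = Q.CE ^ p * ((epsCoupling P U n) ^ (p - 1) * (2 : ℝ) ^ ((3 * (p : ℤ) - 5) * n)) := by ring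
    _ ≤ e ^ p * ((epsCoupling P U n) ^ (p - 1) * (2 : ℝ) ^ ((3 * (p : ℤ) - 5) * n)) := mul_le_mul_of_nonneg_right hpow h2
    _ = _ := by ring

omit [NeZero M] in
/-- **The levelled norms lift along the `CE`-raise** (`0 ≤ Q.CE ≤ e`, `0 ≤ P.Klam`). -/
theorem kernelNormsLevels_withCE_of (hCE0 : 0 ≤ Q.CE) (he : Q.CE ≤ e) (hK : 0 ≤ P.Klam) (h : KernelNormsLevels L M P Q β U μ K n) :
    KernelNormsLevels L M P (Q.withCE e) β U μ K n := by
  intro p hp Ωe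
  refine (h p hp Ωe).trans ?_
  rw [EngConsts.withCE_CE]
  have hε : 0 ≤ epsCoupling P U n := epsCoupling_nonneg' hK U n
  have hpow : Q.CE ^ p ≤ e ^ p := pow_le_pow_left₀ hCE0 he p
  have h2 : 0 ≤ (epsCoupling P U n) ^ (p - 1) * (2 : ℝ) ^ ((3 * (p : ℤ) - 5) * n) * (((2 : ℝ) ^ n)⁻¹) ^ levelGainExp (levelCount Ωe) :=
    mul_nonneg (mul_nonneg (pow_nonneg hε _) (zpow_nonneg (by norm_num) _)) (pow_nonneg (by positivity) _)
  calc Q.CE ^ p * (epsCoupling P U n) ^ (p - 1) * (2 : ℝ) ^ ((3 * (p : ℤ) - 5) * n) * (((2 : ℝ) ^ n)⁻¹) ^ levelGainExp (levelCount Ωe)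
      = Q.CE ^ p * ((epsCoupling P U n) ^ (p - 1) * (2 : ℝ) ^ ((3 * (p : ℤ) - 5) * n) * (((2 : ℝ) ^ n)⁻¹) ^ levelGainExp (levelCount Ωe)) := by
        ring
    _ ≤ e ^ p * ((epsCoupling P U n) ^ (p - 1) * (2 : ℝ) ^ ((3 * (p : ℤ) - 5) * n) * (((2 : ℝ) ^ n)⁻¹) ^ levelGainExp (levelCount Ωe)) :=
        mul_le_mul_of_nonneg_right hpow h2
    _ = _ := by ring

omit [NeZero M] in
/-- **The weighted levels at the (E1-W) budget lift along the `CE`-raise** (`0 ≤ Q.CE ≤ e`, `0 ≤ P.Klam`; a larger budget is still met). -/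
theorem kernelNormsWt4_klWtBudget_withCE_of (hCE0 : 0 ≤ Q.CE) (he : Q.CE ≤ e) (hK : 0 ≤ P.Klam) {j : ℕ}
    (h : KernelNormsWt4 L M (klWtBudget P Q U j) β U μ K j) : KernelNormsWt4 L M (klWtBudget P (Q.withCE e) U j) β U μ K j :=
  h.mono fun m => klWtBudget_le_withCE P hCE0 he hK U j m

/-- **The cured engine slot lifts along the `CE`-raise** (`0 ≤ Q.CE ≤ e`, `0 ≤ P.Klam`; every scale `n`): (E1-v4) monotonically, everything else verbatim. -/
theorem engineBoundsAtV17F2_withCE_of (hCE0 : 0 ≤ Q.CE) (he : Q.CE ≤ e) (hK : 0 ≤ P.Klam) (h : EngineBoundsAtV17F2 L M G P Q β U μ n) :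
    EngineBoundsAtV17F2 L M G P (Q.withCE e) β U μ n := by
  obtain ⟨h0, h1, h2, h3, h4, h5, h6, h7⟩ := h
  exact ⟨h0, kernelNormsV4_withCE_of hCE0 he hK h1, h2, h3, h4, h5, h6, h7⟩

/-- **The comparison-volume history conjunct `histV17F2` lifts along the `CE`-raise** (`0 ≤ Q.CE ≤ e`, `0 ≤ P.Klam`). -/
theorem histV17F2_withCE_of (hCE0 : 0 ≤ Q.CE) (he : Q.CE ≤ e) (hK : 0 ≤ P.Klam) {j : ℕ} (h : histV17F2 L M G P Q R β U μ j) :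
    histV17F2 L M G P (Q.withCE e) R β U μ j :=
  ⟨h.1, h.2.1, engineBoundsAtV17F2_withCE_of hCE0 he hK h.2.2.1, h.2.2.2⟩

end Model

/-! ## §2 `IsRaiseOf` doors -/

section Raise

variable {L M : ℕ} [NeZero L] [NeZero M] {G : GeoConsts} {P : SplitConsts} {Q₀ Q : EngConsts} {R : RenConsts} {β U μ : ℝ}
  {K : TrigPolyC4v} {n : ℕ}

/-- **(E2-F2)ₙ lifts along any raise** (`0 ≤ P.Klam`). -/
theorem pairLadderStepAtV17F2_of_isRaiseOf (hQ : Q₀.IsRaiseOf Q) (hK : 0 ≤ P.Klam) (h : PairLadderStepAtV17F2 L M G P Q₀ β U μ n) :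
    PairLadderStepAtV17F2 L M G P Q β U μ n := by
  rw [hQ.eq]; exact pairLadderStepAtV17F2_withCE_iff.2 (pairLadderStepAtV17F2_withCR_of hQ.CR_le hK h)

/-- **(E2″-F)ₙ lifts along any raise** (`0 ≤ P.Klam`). -/
theorem pairValueIncrementAtV17F_of_isRaiseOf (hQ : Q₀.IsRaiseOf Q) (hK : 0 ≤ P.Klam) (h : PairValueIncrementAtV17F L M G P Q₀ β U μ n) :
    PairValueIncrementAtV17F L M G P Q β U μ n := by
  rw [hQ.eq]; exact pairValueIncrementAtV17F_withCE_iff.2 (pairValueIncrementAtV17F_withCR_of hQ.CR_le hK h)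

/-- **(E2′-F)ₙ lifts along any raise** (`0 ≤ P.Klam`). -/
theorem quarticValueIncrementAtV17F_of_isRaiseOf (hQ : Q₀.IsRaiseOf Q) (hK : 0 ≤ P.Klam) (h : QuarticValueIncrementAtV17F L M G P Q₀ β U μ n) :
    QuarticValueIncrementAtV17F L M G P Q β U μ n := by
  rw [hQ.eq]; exact quarticValueIncrementAtV17F_withCE_iff.2 (quarticValueIncrementAtV17F_withCR_of hQ.CR_le hK h)

/-- **(E2′-F UV)ₙ lifts along any raise** (`0 ≤ P.Klam`). -/
theorem quarticValueUVAtV17F_of_isRaiseOf (hQ : Q₀.IsRaiseOf Q) (hK : 0 ≤ P.Klam) (h : QuarticValueUVAtV17F L M G P Q₀ β U μ n) :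
    QuarticValueUVAtV17F L M G P Q β U μ n := by
  rw [hQ.eq]; exact quarticValueUVAtV17F_withCE_iff.2 (quarticValueUVAtV17F_withCR_of hQ.CR_le hK h)

/-- **(B1-F) lifts along any raise** (`0 ≤ P.Klam`). -/
theorem pairArrayAtV17F_of_isRaiseOf (hQ : Q₀.IsRaiseOf Q) (hK : 0 ≤ P.Klam) (h : PairArrayAtV17F L M P Q₀ β U μ n) :
    PairArrayAtV17F L M P Q β U μ n := by
  rw [hQ.eq]; exact pairArrayAtV17F_withCE_iff.2 (pairArrayAtV17F_withCR_of hQ.CR_le hK h)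

/-- **The split slot lifts along any raise** (`0 ≤ P.Klam`). -/
theorem betaSplitAtV17F_of_isRaiseOf (hQ : Q₀.IsRaiseOf Q) (hK : 0 ≤ P.Klam) (h : BetaSplitAtV17F L M G P Q₀ β U μ n) :
    BetaSplitAtV17F L M G P Q β U μ n := by
  rw [hQ.eq]; exact betaSplitAtV17F_withCE_iff.2 (betaSplitAtV17F_withCR_of hQ.CR_le hK h)

omit [NeZero M] in
/-- **(E1-v4) lifts along any raise** (`0 ≤ Q₀.CE`, `0 ≤ P.Klam`). -/
theorem kernelNormsV4_of_isRaiseOf (hQ : Q₀.IsRaiseOf Q) (hCE0 : 0 ≤ Q₀.CE) (hK : 0 ≤ P.Klam) (h : KernelNormsV4 L M P Q₀ β U μ K n) :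
    KernelNormsV4 L M P Q β U μ K n := by
  rw [hQ.eq]; exact kernelNormsV4_withCE_of (Q := Q₀.withCR Q.CR) hCE0 hQ.CE_le hK (kernelNormsV4_withCR_iff.2 h)

omit [NeZero M] in
/-- **The levelled norms lift along any raise** (`0 ≤ Q₀.CE`, `0 ≤ P.Klam`). -/
theorem kernelNormsLevels_of_isRaiseOf (hQ : Q₀.IsRaiseOf Q) (hCE0 : 0 ≤ Q₀.CE) (hK : 0 ≤ P.Klam) (h : KernelNormsLevels L M P Q₀ β U μ K n) :
    KernelNormsLevels L M P Q β U μ K n := by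
  rw [hQ.eq]; exact kernelNormsLevels_withCE_of (Q := Q₀.withCR Q.CR) hCE0 hQ.CE_le hK (kernelNormsLevels_withCR_iff.2 h)

omit [NeZero L] [NeZero M] in
/-- **The (E1-W) budget is monotone along any raise** (`0 ≤ Q₀.CE`, `0 ≤ P.Klam`). -/
theorem klWtBudget_le_of_isRaiseOf (hQ : Q₀.IsRaiseOf Q) (hCE0 : 0 ≤ Q₀.CE) (hK : 0 ≤ P.Klam) (U : ℝ) (j m : ℕ) :
    klWtBudget P Q₀ U j m ≤ klWtBudget P Q U j m := by
  rw [hQ.eq, ← klWtBudget_withCR P Q₀ Q.CR U j m]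
  exact klWtBudget_le_withCE P hCE0 hQ.CE_le hK U j m

omit [NeZero M] in
/-- **The weighted levels at the budget lift along any raise** (`0 ≤ Q₀.CE`, `0 ≤ P.Klam`). -/
theorem kernelNormsWt4_klWtBudget_of_isRaiseOf (hQ : Q₀.IsRaiseOf Q) (hCE0 : 0 ≤ Q₀.CE) (hK : 0 ≤ P.Klam) {j : ℕ}
    (h : KernelNormsWt4 L M (klWtBudget P Q₀ U j) β U μ K j) : KernelNormsWt4 L M (klWtBudget P Q U j) β U μ K j :=
  h.mono fun m => klWtBudget_le_of_isRaiseOf hQ hCE0 hK U j m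

/-- (E4) is INVARIANT along any raise (`cE4` pinned). -/
theorem engineFirstMoments_isRaiseOf_iff (hQ : Q₀.IsRaiseOf Q) :
    EngineFirstMoments L M G P Q β U μ K n ↔ EngineFirstMoments L M G P Q₀ β U μ K n := by
  rw [hQ.eq]; exact Iff.rfl

/-- (E3a-F) is INVARIANT along any raise (`S'` pinned). -/
theorem twoLegReadJetsF_isRaiseOf_iff (hQ : Q₀.IsRaiseOf Q) : TwoLegReadJetsF L M G Q β U μ n ↔ TwoLegReadJetsF L M G Q₀ β U μ n := by
  rw [hQ.eq]; exact Iff.rfl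

/-- (E3f-F) at `n = 0` is INVARIANT along any raise, for any two histories (`M0`, `CL` pinned). -/
theorem twoLegVolumeRateF_zero_isRaiseOf_iff (hQ : Q₀.IsRaiseOf Q) (hist hist' : (L' M' : ℕ) → [NeZero L'] → [NeZero M'] → ℕ → Prop) :
    TwoLegVolumeRateF L M hist Q β U μ 0 ↔ TwoLegVolumeRateF L M hist' Q₀ β U μ 0 := by
  rw [hQ.eq]
  exact (twoLegVolumeRateF_zero_withCE_iff hist hist').trans (twoLegVolumeRateF_zero_withCR_iff hist' hist')

/-- **The cured engine slot lifts along any raise** (`0 ≤ Q₀.CE`, `0 ≤ P.Klam`; every scale `n`). -/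
theorem engineBoundsAtV17F2_of_isRaiseOf (hQ : Q₀.IsRaiseOf Q) (hCE0 : 0 ≤ Q₀.CE) (hK : 0 ≤ P.Klam) (h : EngineBoundsAtV17F2 L M G P Q₀ β U μ n) :
    EngineBoundsAtV17F2 L M G P Q β U μ n := by
  rw [hQ.eq]
  exact engineBoundsAtV17F2_withCE_of (Q := Q₀.withCR Q.CR) hCE0 hQ.CE_le hK (engineBoundsAtV17F2_withCR_of hQ.CR_le hK h)

/-- **The comparison-volume history conjunct lifts along any raise** (`0 ≤ Q₀.CE`, `0 ≤ P.Klam`).  (The two-leg SLOT does not lift: it consumes this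
history as a hypothesis — antitone.) -/
theorem histV17F2_of_isRaiseOf (hQ : Q₀.IsRaiseOf Q) (hCE0 : 0 ≤ Q₀.CE) (hK : 0 ≤ P.Klam) {j : ℕ} (h : histV17F2 L M G P Q₀ R β U μ j) :
    histV17F2 L M G P Q R β U μ j := by
  rw [hQ.eq]
  exact histV17F2_withCE_of (Q := Q₀.withCR Q.CR) hCE0 hQ.CE_le hK (histV17F2_withCR_of hQ.CR_le hK h)

/-- **What a raised engine slot gives a `Q₀`-keyed consumer**: (E4)/(E3a)/(E5-F)/symmetry verbatim at `Q₀`, (E1-v4) and the four value clauses at `Q`. -/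
theorem engineBoundsAtV17F2_isRaiseOf_iff_of_values (hQ : Q₀.IsRaiseOf Q) :
    EngineBoundsAtV17F2 L M G P Q β U μ n ↔
      (SelfEnergySymmetric L M β U μ (klFlowFrameU L M β U μ n) n ∧ KernelNormsV4 L M P Q β U μ (klFlowFrameU L M β U μ n) n ∧
        PairLadderStepAtV17F2 L M G P Q β U μ n ∧ PairValueIncrementAtV17F L M G P Q β U μ n ∧
          QuarticValueIncrementAtV17F L M G P Q β U μ n ∧ QuarticValueUVAtV17F L M G P Q β U μ n ∧
            EngineFirstMoments L M G P Q₀ β U μ (klFlowFrameU L M β U μ n) n ∧ IsoTupleL1AtV17F L M G P β U μ n) := by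
  rw [← engineFirstMoments_isRaiseOf_iff hQ]; exact Iff.rfl

end Raise

end Summit.HubbardSuperconductivity.HubbardSuperconductivity.Theorems.KLRegimeSplit

end
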